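import Summits.NavierStokesRegularity.NavierStokesRegularity.Theorems.TypeIQuarterGateQuarterLawTypeIOctaveSampling
import Summits.NavierStokesRegularity.NavierStokesRegularity.Theorems.TypeIQuarterGateQuarterLawTypeIExponentWindow
import HarnessLib

/-!
# `TypeIQuarterGate`: the DEPLETED ENSTROPHY `Z(t)(T−t)^{κ²C²/2}` IS NON-INCREASING ALONG A TYPE-I
# BLOW-UP — two-time form, and the SHARP octave transfer (crux `QuarterLawTypeI`, 23726)

`--supports stmt-NavierStokesRegularity-23726` (helper; sequel to p824687 / p824748).

Along a classical Leray–Hopf rapidly-decaying-datum solution on `[0,T)` with the rate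
`√(T−σ)‖u(σ,x)‖ ≤ C√ν` on `(a₀,T)`, `Z(t) = ∫‖curl u(t)‖²`, `κ = (2+√3)/9` the tree's sharp
strain-cube depletion constant, `γ = κ²C²/2`:

* `lintegral_curl_sq_le_rpow_mul_of_rate` — **TWO-TIME DEPLETED GRÖNWALL**: for `0 ≤ s ≤ t < T` past
  the onset, `Z(t) ≤ ((T−s)/(T−t))^γ · Z(s)`.  (The tree had only the form anchored at time `0`,
  `Z(t) ≤ K(T−t)^{−γ}` — `QuarterLawExponent.lintegral_curl_sq_le_rpow_sharp_of_rate`, p820231.  Proof: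
  Tao's class restarted at `s` (`IsTaoSolutionOn.translate`), the flow-wise slab Grönwall
  `DepletionLadder.lintegral_curl_sq_le_exp_of_flowwise` fed with `QuarterLawExponent.sharpDepletion_along`,
  and `∫_s^t C²ν/(T−σ) dσ = C²ν log((T−s)/(T−t))`.)
* `depletedEnstrophy_antitone` — equivalently **`Z(t)(T−t)^γ ≤ Z(s)(T−s)^γ`**: hypothesis (A) of the
  bookkeeping ceiling `QuarterLawCeiling.bookkeeping_ceiling` (p824748) is now literally a per-solution
  tree theorem.
* `lintegral_curl_sq_le_of_goodSlice_sharp` — **SHARP OCTAVE TRANSFER**: one good slice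
  `Z(s) ≤ B/√(T−s)` controls its forward `q`-octave with the POLYNOMIAL factor `q^γ`,
  `Z(t) ≤ q^γ B/√(T−t)` (p824687's `lintegral_curl_sq_le_of_goodSlice` had `e^{C²(q−1)/2}`).  In the
  logarithmic clock `τ = −log(T−t)` the dimensionless enstrophy `Z√(T−t)` of a K1-violator can grow at
  rate at most `γ − 1/2` (numbers: `γ − 1/2 = κ²C²/2 − 1/2`, zero exactly at the rung `C = 18 − 9√3`).

HONEST FRAMING: a-priori bookkeeping along a HYPOTHETICAL blow-up; `QuarterLawTypeI` remains OPEN;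
nothing about Navier–Stokes regularity is claimed. [folklore]
-/

-- the problem directory repeats the summit name (`NavierStokesRegularity/NavierStokesRegularity`)
set_option linter.dupNamespace false

noncomputable section

open Set Filter Topology MeasureTheory
open scoped ENNReal NNReal RealInnerProductSpace

namespace Summit.NavierStokesRegularity.NavierStokesRegularity.Theorems

namespace QuarterLawOctave

open Literature.Analysis.FluidPDE
open Summit.NavierStokesRegularity.NavierStokesRegularity.Theorems.QuarterLawWindow
  (exists_isTaoSolutionOn_of_frame)
open Summit.NavierStokesRegularity.NavierStokesRegularity.Theorems.RungReynoldsOne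
  (toReal_eLpNorm_top_le_of_bound lintegral_Ioo_div_sub_eq)
open Summit.NavierStokesRegularity.NavierStokesRegularity.Theorems.DepletionLadder
  (lintegral_curl_sq_le_exp_of_flowwise)
open Summit.NavierStokesRegularity.NavierStokesRegularity.Theorems.QuarterLawExponent
  (sharpDepletion_along)

/-! ### Two-time depleted Grönwall under the rate -/

/-- **Two-time depleted Grönwall.** Along a classical Leray–Hopf rapidly-decaying-datum solution on
`[0,T)` (`ν, T > 0`) with the rate `√(T−σ)‖u(σ,x)‖ ≤ C√ν` for `σ ∈ (a₀,T)`: for `0 ≤ s`, `a₀ < s ≤ t < T`,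
`∫‖curl u(t)‖² ≤ ((T−s)/(T−t))^{κ²C²/2} · ∫‖curl u(s)‖²`, `κ = (2+√3)/9`. [folklore] -/
theorem lintegral_curl_sq_le_rpow_mul_of_rate {ν T C a₀ s t : ℝ} (hν : 0 < ν) (hT : 0 < T)
    {u : ℝ → EuclideanSpace ℝ (Fin 3) → EuclideanSpace ℝ (Fin 3)}
    {p : ℝ → EuclideanSpace ℝ (Fin 3) → ℝ}
    (hsol : IsClassicalNSSolutionOn (Ico 0 T) ν 0 u p) (hLH : IsLerayHopfOn T ν 0 (u 0) u)
    (hdec : HasRapidSpatialDecay (u 0))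
    (hrate : ∀ σ ∈ Ioo a₀ T, ∀ x, Real.sqrt (T - σ) * ‖u σ x‖ ≤ C * Real.sqrt ν)
    (hs0 : 0 ≤ s) (ha₀s : a₀ < s) (hst : s ≤ t) (htT : t < T) :
    ∫⁻ x, ‖curl (u t) x‖ₑ ^ 2 ≤
      ENNReal.ofReal (((T - s) / (T - t)) ^ (((2 + Real.sqrt 3) / 9) ^ 2 * C ^ 2 / 2)) *
        ∫⁻ x, ‖curl (u s) x‖ₑ ^ 2 := by
  set κ : ℝ := (2 + Real.sqrt 3) / 9 with hκ
  have hTt : 0 < T - t := sub_pos.2 htT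
  rcases hst.eq_or_lt with rfl | hst'
  · rw [div_self hTt.ne', Real.one_rpow, ENNReal.ofReal_one, one_mul]
  have hts : 0 < t - s := sub_pos.2 hst'
  have hr : 0 < (T - s) / (T - t) := div_pos (by linarith) hTt
  -- Tao's class on `[0,(t+T)/2]`, restarted at `s` and cut at `t − s`
  have hT' : (t + T) / 2 ∈ Ioo 0 T := ⟨by linarith, by linarith⟩
  obtain ⟨P, hP⟩ := exists_isTaoSolutionOn_of_frame hν hsol hLH hdec hT'
  have h2 : IsTaoSolutionOn (t - s) ν (u s) (fun r => u (r + s)) (fun r => P (r + s)) :=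
    (hP.translate hs0 (by linarith)).mono hts (by linarith)
  -- the sharp depletion along the translate (slice-wise)
  have hflow : ∀ r ∈ Icc 0 (t - s), ∀ M : ℝ, (∀ x, ‖u (r + s) x‖ ≤ M) →
      |∫ x, ⟪curl (u (r + s)) x, fderiv ℝ (u (r + s)) x (curl (u (r + s)) x)⟫| ≤
        κ * M * Real.sqrt (∫ x, ‖curl (u (r + s)) x‖ ^ 2) *
          Real.sqrt (∫ x, frobeniusNormSq (fderiv ℝ (curl (u (r + s))) x)) :=
    fun r hr M hM => sharpDepletion_along hν hT hsol hLH hdec (r + s)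
      ⟨by linarith [hr.1], by linarith [hr.2]⟩ M hM
  -- the squared sup norm along the translate: `‖u(r+s)‖²_∞ ≤ C²ν/((T−s)−r)`
  have hC2 : 0 ≤ C ^ 2 * ν := by positivity
  have hNsq : ∀ r ∈ Ioo 0 (t - s),
      (eLpNorm (u (r + s)) ⊤ volume).toReal ^ (2 : ℝ) ≤ C ^ 2 * ν / ((T - s) - r) := by
    intro r hr
    have hσT : r + s < T := by linarith [hr.2]
    have hσa : a₀ < r + s := by linarith [hr.1]
    have hTσ : 0 < T - (r + s) := sub_pos.2 hσT
    have hsq : 0 < Real.sqrt (T - (r + s)) := Real.sqrt_pos.2 hTσ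
    -- `C ≥ 0` is forced by the rate at `r + s`
    have hC0 : 0 ≤ C * Real.sqrt ν := le_trans (by positivity) (hrate (r + s) ⟨hσa, hσT⟩ 0)
    have hb : 0 ≤ C * Real.sqrt ν / Real.sqrt (T - (r + s)) := div_nonneg hC0 hsq.le
    have h1 : ∀ x, ‖u (r + s) x‖ ≤ C * Real.sqrt ν / Real.sqrt (T - (r + s)) := fun x => by
      rw [le_div_iff₀ hsq, mul_comm]; exact hrate (r + s) ⟨hσa, hσT⟩ x
    have h2 := toReal_eLpNorm_top_le_of_bound hb h1
    have h3 := pow_le_pow_left₀ ENNReal.toReal_nonneg h2 2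
    rw [Real.rpow_two]
    refine h3.trans (le_of_eq ?_)
    rw [div_pow, mul_pow, Real.sq_sqrt hν.le, Real.sq_sqrt hTσ.le]
    congr 1; ring
  -- the integrated squared sup norm: `≤ C²ν log((T−s)/(T−t))`
  have hΛ : ∫⁻ r in Ioo 0 (t - s), ENNReal.ofReal ((eLpNorm (u (r + s)) ⊤ volume).toReal ^ (2 : ℝ)) ≤
      ENNReal.ofReal (C ^ 2 * ν * Real.log ((T - s) / (T - t))) := by
    calc ∫⁻ r in Ioo 0 (t - s), ENNReal.ofReal ((eLpNorm (u (r + s)) ⊤ volume).toReal ^ (2 : ℝ))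
        ≤ ∫⁻ r in Ioo 0 (t - s), ENNReal.ofReal (C ^ 2 * ν / ((T - s) - r)) :=
          setLIntegral_mono' measurableSet_Ioo fun r hr => ENNReal.ofReal_le_ofReal (hNsq r hr)
      _ = ENNReal.ofReal (C ^ 2 * ν * Real.log ((T - s) / ((T - s) - (t - s)))) :=
          lintegral_Ioo_div_sub_eq hC2 hts.le (by linarith)
      _ = ENNReal.ofReal (C ^ 2 * ν * Real.log ((T - s) / (T - t))) := by
          rw [show (T - s) - (t - s) = T - t by ring]
  have hΛtop : ∫⁻ r in Ioo 0 (t - s),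
      ENNReal.ofReal ((eLpNorm (u (r + s)) ⊤ volume).toReal ^ (2 : ℝ)) ≠ ⊤ :=
    (hΛ.trans_lt ENNReal.ofReal_lt_top).ne
  -- Grönwall on the translate
  have hmain := lintegral_curl_sq_le_exp_of_flowwise hν hts h2.classical hflow h2.sobolev
    h2.sobolev_dt ⟨hts, le_rfl⟩ hΛtop
  simp only [sub_add_cancel, zero_add] at hmain
  refine hmain.trans (mul_le_mul' (ENNReal.ofReal_le_ofReal ?_) le_rfl)
  -- `exp((κ²/(2ν)) Λ) ≤ ((T−s)/(T−t))^{κ²C²/2}`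
  have hlog : 0 ≤ Real.log ((T - s) / (T - t)) :=
    Real.log_nonneg ((one_le_div hTt).2 (by linarith))
  have h1 : (∫⁻ r in Ioo 0 (t - s),
      ENNReal.ofReal ((eLpNorm (u (r + s)) ⊤ volume).toReal ^ (2 : ℝ))).toReal ≤
      C ^ 2 * ν * Real.log ((T - s) / (T - t)) :=
    ENNReal.toReal_le_of_le_ofReal (mul_nonneg hC2 hlog) hΛ
  have hk0 : 0 ≤ κ ^ 2 / (2 * ν) := by positivity
  have h2 := Real.exp_le_exp.2 (mul_le_mul_of_nonneg_left h1 hk0)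
  refine h2.trans (le_of_eq ?_)
  rw [Real.rpow_def_of_pos hr]
  congr 1
  field_simp

/-- **(A) The depleted enstrophy is non-increasing along the flow**: under the same hypotheses,
`∫‖curl u(t)‖² · (T−t)^γ ≤ ∫‖curl u(s)‖² · (T−s)^γ`, `γ = κ²C²/2` — hypothesis (A) of
`QuarterLawCeiling.bookkeeping_ceiling`, per solution. [folklore] -/
theorem depletedEnstrophy_antitone {ν T C a₀ s t : ℝ} (hν : 0 < ν) (hT : 0 < T)
    {u : ℝ → EuclideanSpace ℝ (Fin 3) → EuclideanSpace ℝ (Fin 3)}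
    {p : ℝ → EuclideanSpace ℝ (Fin 3) → ℝ}
    (hsol : IsClassicalNSSolutionOn (Ico 0 T) ν 0 u p) (hLH : IsLerayHopfOn T ν 0 (u 0) u)
    (hdec : HasRapidSpatialDecay (u 0))
    (hrate : ∀ σ ∈ Ioo a₀ T, ∀ x, Real.sqrt (T - σ) * ‖u σ x‖ ≤ C * Real.sqrt ν)
    (hs0 : 0 ≤ s) (ha₀s : a₀ < s) (hst : s ≤ t) (htT : t < T) :
    (∫⁻ x, ‖curl (u t) x‖ₑ ^ 2) *
        ENNReal.ofReal ((T - t) ^ (((2 + Real.sqrt 3) / 9) ^ 2 * C ^ 2 / 2)) ≤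
      (∫⁻ x, ‖curl (u s) x‖ₑ ^ 2) *
        ENNReal.ofReal ((T - s) ^ (((2 + Real.sqrt 3) / 9) ^ 2 * C ^ 2 / 2)) := by
  set γ : ℝ := ((2 + Real.sqrt 3) / 9) ^ 2 * C ^ 2 / 2 with hγ
  have hTt : 0 < T - t := sub_pos.2 htT
  have hTs : 0 < T - s := by linarith
  have h := lintegral_curl_sq_le_rpow_mul_of_rate hν hT hsol hLH hdec hrate hs0 ha₀s hst htT
  have hsplit : ((T - s) / (T - t)) ^ γ * (T - t) ^ γ = (T - s) ^ γ := by
    rw [← Real.mul_rpow (div_pos hTs hTt).le hTt.le, div_mul_cancel₀ _ hTt.ne']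
  calc (∫⁻ x, ‖curl (u t) x‖ₑ ^ 2) * ENNReal.ofReal ((T - t) ^ γ)
      ≤ ENNReal.ofReal (((T - s) / (T - t)) ^ γ) * (∫⁻ x, ‖curl (u s) x‖ₑ ^ 2) *
          ENNReal.ofReal ((T - t) ^ γ) := mul_le_mul' h le_rfl
    _ = (∫⁻ x, ‖curl (u s) x‖ₑ ^ 2) *
          (ENNReal.ofReal (((T - s) / (T - t)) ^ γ) * ENNReal.ofReal ((T - t) ^ γ)) := by ring
    _ = (∫⁻ x, ‖curl (u s) x‖ₑ ^ 2) * ENNReal.ofReal ((T - s) ^ γ) := by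
          rw [← ENNReal.ofReal_mul (Real.rpow_nonneg (div_pos hTs hTt).le _), hsplit]

/-! ### The sharp octave transfer -/

/-- **Sharp octave transfer.** Same frame and rate: if `0 ≤ s`, `a₀ < s ≤ t < T`, `T − s ≤ q(T − t)`
and `∫‖curl u(s)‖² ≤ B/√(T−s)` with `B ≥ 0`, then `∫‖curl u(t)‖² ≤ q^{κ²C²/2} B/√(T−t)` — a factor
POLYNOMIAL in the octave ratio `q` (compare `lintegral_curl_sq_le_of_goodSlice`: `e^{C²(q−1)/2}`).
[folklore] -/
theorem lintegral_curl_sq_le_of_goodSlice_sharp {ν T C q a₀ s t B : ℝ} (hν : 0 < ν) (hT : 0 < T)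
    {u : ℝ → EuclideanSpace ℝ (Fin 3) → EuclideanSpace ℝ (Fin 3)}
    {p : ℝ → EuclideanSpace ℝ (Fin 3) → ℝ}
    (hsol : IsClassicalNSSolutionOn (Ico 0 T) ν 0 u p) (hLH : IsLerayHopfOn T ν 0 (u 0) u)
    (hdec : HasRapidSpatialDecay (u 0))
    (hrate : ∀ σ ∈ Ioo a₀ T, ∀ x, Real.sqrt (T - σ) * ‖u σ x‖ ≤ C * Real.sqrt ν)
    (hs0 : 0 ≤ s) (ha₀s : a₀ < s) (hst : s ≤ t) (htT : t < T)
    (hq : T - s ≤ q * (T - t)) (hB : 0 ≤ B)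
    (hZs : ∫⁻ x, ‖curl (u s) x‖ₑ ^ 2 ≤ ENNReal.ofReal (B / Real.sqrt (T - s))) :
    ∫⁻ x, ‖curl (u t) x‖ₑ ^ 2 ≤
      ENNReal.ofReal (q ^ (((2 + Real.sqrt 3) / 9) ^ 2 * C ^ 2 / 2) * B / Real.sqrt (T - t)) := by
  set γ : ℝ := ((2 + Real.sqrt 3) / 9) ^ 2 * C ^ 2 / 2 with hγ
  have hγ0 : 0 ≤ γ := by positivity
  have hTt : 0 < T - t := sub_pos.2 htT
  have hTs : 0 < T - s := by linarith
  have hr0 : 0 ≤ (T - s) / (T - t) := (div_pos hTs hTt).le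
  have hrq : (T - s) / (T - t) ≤ q := by rw [div_le_iff₀ hTt]; exact hq
  have hq0 : 0 ≤ q := hr0.trans hrq
  have h := lintegral_curl_sq_le_rpow_mul_of_rate hν hT hsol hLH hdec hrate hs0 ha₀s hst htT
  have hrpow : ((T - s) / (T - t)) ^ γ ≤ q ^ γ := Real.rpow_le_rpow hr0 hrq hγ0
  have hsqrt : B / Real.sqrt (T - s) ≤ B / Real.sqrt (T - t) :=
    div_le_div_of_nonneg_left hB (Real.sqrt_pos.2 hTt) (Real.sqrt_le_sqrt (by linarith))
  calc ∫⁻ x, ‖curl (u t) x‖ₑ ^ 2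
      ≤ ENNReal.ofReal (((T - s) / (T - t)) ^ γ) * ∫⁻ x, ‖curl (u s) x‖ₑ ^ 2 := h
    _ ≤ ENNReal.ofReal (q ^ γ) * ENNReal.ofReal (B / Real.sqrt (T - t)) :=
        mul_le_mul' (ENNReal.ofReal_le_ofReal hrpow) (hZs.trans (ENNReal.ofReal_le_ofReal hsqrt))
    _ = ENNReal.ofReal (q ^ γ * B / Real.sqrt (T - t)) := by
        rw [← ENNReal.ofReal_mul (Real.rpow_nonneg hq0 _), mul_div_assoc]

end QuarterLawOctave

end Summit.NavierStokesRegularity.NavierStokesRegularity.Theorems
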